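import Summits.BirchSwinnertonDyer.BirchSwinnertonDyer.Theorems.ErratumRoadFiveNonSurjCornerHybridBadCarriers
import Summits.BirchSwinnertonDyer.BirchSwinnertonDyer.Theorems.ErratumRoadFiveRest3ShaAnCertificate
import HarnessLib

/-!
# Route `ErratumRoadFive` (rung K2), crux `NonSurjCorner` (item stmt-BirchSwinnertonDyer-19065), registered line `Lines/hybrid.lean`: THE `Ш_an` CUT
# OF THE CONVERSE-GRADE STUBS — the Kolyvagin certificates (`stub_kolyZ57` = 19946) are needed ONLY at the corner pairs with `p ∣ #Ш(E)_an`
# (census: 0 of 64 at `p = 5`), and the twins' lower half (`stub_lowerX11a57` = 19064) ONLY at the twists with `p ∣ #Ш(E^d)_an`; glue #7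
# (cell `bsd-stepL`, seat `bsd-stepL-corner-p1` g14; `--supports stmt-BirchSwinnertonDyer-19065 --as helper`)

WHY THIS FILE. In the hybrid glue (p579499 ∕ glue #6) the proof is pointwise in the pair `(E, p)`: the UPPER half `Typed.MissingUpperBoundAt W p`
comes from the Jetchev MAX form ∕ the Shimura roads (no Kolyvagin certificate involved), and the LOWER half `Typed.MissingLowerBoundAt W p`
(`ord_p #Ш(E)_an ≤ ord_p #Ш(E)`) from the certificates Zₚᶜ at the Hoffstein–Luo frame + Cha's structure theorem + the twin's Euler-system half.
But the upper half already exhibits `#Ш(E)_an = s ∈ ℚ`, and whenever `ord_p s ≤ 0` the lower half is TRIVIAL (`0 ≤ ord_p #Ш(E)`; the route's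
own `missingLowerBoundAt_of_shaAn_nonpos`, rest-p2's `Ш_an` certificate for REST‴, p-landed in `ErratumRoadFiveRest3ShaAnCertificate.lean`). So the
Kolyvagin certificates are consumed ONLY at the pairs with `0 < ord_p #Ш(E)_an` — and there (by Gross–Zagier + the twin's upper half) EVERY frame is
DEEP, so the seat's deep-locus restriction (p591598 `nonSurjCornerKolyZ_of_bottom_not_pow_divisible'`) composes with it at no cost. Likewise the
twin input `X11aLowerHalf` is consumed only as `Typed.MissingLowerBoundAt Wd p` at twists `Wd`, trivial unless no rational value of `#Ш(Wd)_an`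
has `ord_p ≤ 0`. CENSUS (p = 5, N < 5·10⁵, HOME/corner/g3/corner57.tsv): ALL 64 corner pairs have `#Ш(E)_an = 1` ⇒ the thinned Kolyvagin stub has
population 0 on the census (class-wide it is the set of corner pairs with `p ∣ #Ш(E)_an`, where — granted BSD — `Ш(E)[p] ≠ 0` must be PRODUCED:
Kolyvagin's conjecture proper); the thinned twin stub has population = the twists with `5 ∣ #Ш(E^d)_an` (16 of 256 classified (pair, twin) frames in
lane B corner5-p2 g7's CERT-TWINMUAN-5-g7.tsv).

* §1 **`X11b.erratumRoadFive_nonSurjCorner_of_kolyZShaAn_of_kolyJMax_of_multiUpper_of_lowerX11aShaAn_of_twinMultDivisibility`** — the hybrid cut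
  p579499 with `hZ` ↦ **`hZan`** (certificates only at pairs with `∃ s, #Ш(E)_an = s ∧ 0 < ord_p s`, and only at DEEP frames) and `h₄` ↦ **`h₄an`**
  (the X11a lower half only at curves `Wd` with `∀ q, #Ш(Wd)_an = q → 0 < ord_p q`).
* §2 **glue #7 `nonSurjCorner_of_kolyZShaAn_of_twinMuAn_of_katoFacts_of_lowerX11aShaAn_of_sixNamedInputs_of_savedDisplay_of_threeBadSplit`** — the
  full hybrid composition (as glue #6, p593645) over {`hZan`, 19948, 19949, `h₄an`, hMax (3), hShim6 (6), hSav, hres3bad}. Candidate composition of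
  `Lines/hybrid.lean` r4; the registered by-name stubs `stub_kolyZ57` (19946) and `stub_lowerX11a57` (19064) imply `hZan` ∕ `h₄an` a fortiori, so the
  planner may thin either, both, or neither.

HONEST FRAMING: THEOREMS ONLY (no definition, no named fact, no `sorry`); CONDITIONAL on every displayed binder; the `Ш_an` conditions are
statements about the ANALYTIC order (data per pair, never asserted); item 19065 is NOT closed; nothing about any curve's BSD; BSD is not advanced; T7.
References (locators only): [cite: Miller2011LMS, §1 and Def. 1.1] [cite: Cha2005, Thm. 21 and Rmk. 25] [cite: JetchevSkinnerWan2017, §7.4.1–7.4.2]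
[cite: Cremona1997, Table 4 (`#Ш_an`)] [cite: GrossZagier1986, V §2 (2.2)].
-/

set_option autoImplicit false
set_option linter.dupNamespace false -- `Summit.BirchSwinnertonDyer.BirchSwinnertonDyer` (summit = problem), tree-wide

noncomputable section

open scoped Classical NumberField MatrixGroups ModularForm

namespace Summit.BirchSwinnertonDyer.Rank1Residual.X11b

open CongruenceSubgroup WeierstrassCurve NumberField IsDedekindDomain Field
  Literature.NumberTheory.EllipticCurves
  Literature.NumberTheory.EllipticCurves.ModularForms
  Literature.NumberTheory.EllipticCurves.Rank1Residual
  Literature.NumberTheory.EllipticCurves.Rank1Residual.Typed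
  Literature.NumberTheory.EllipticCurves.Wuthrich2014
  Literature.NumberTheory.EllipticCurves.SteinWuthrich2013
  Literature.NumberTheory.EllipticCurves.GreenbergVatsal2000
  Literature.NumberTheory.EllipticCurves.EmertonPollackWeston2006
  Literature.NumberTheory.QuadraticFields.Quadratic
  Summit.BirchSwinnertonDyer.Rank1Residual
  Summit.BirchSwinnertonDyer.Rank1Residual.RankZeroHeightFree
  Summit.BirchSwinnertonDyer.Rank1Residual.X11b.Three.Koly
  Summit.BirchSwinnertonDyer.BirchSwinnertonDyer.Theorems

/-! ### §1 The hybrid cut with the converse-grade inputs restricted to `p ∣ #Ш_an` -/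

/-- **THE HYBRID CUT OF CRUX 19065 WITH THE `Ш_an` CUT ON BOTH CONVERSE-GRADE INPUTS.** As
`erratumRoadFive_nonSurjCorner_of_kolyZ_of_kolyJMax_of_multiUpper_of_lowerX11a_of_twinMultDivisibility` (p579499), with two binders THINNED:
`hZan` — Kolyvagin certificates `∃ M ≤ t, CertificateAt Dt β ι p M` only at the corner pairs with `∃ s : ℚ, #Ш(E)_an = s ∧ 0 < ord_p s` and only at
the DEEP frames (a conductor-1 datum whose bottom point lies in `p^{t+1}E(K)`); `h₄an` — the X11a lower half `Typed.MissingLowerBoundAt Wd p` only at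
the curves `Wd` with `∀ q : ℚ, #Ш(Wd)_an = q → 0 < ord_p q`. Proof: pointwise in `(W, p)`; the upper half as in p579499 (MAX form on `t = 0` ∕ mono
pairs, `hUmulti` on multi pairs, the twists' lower half through the trivial case `missingLowerBoundAt_of_shaAn_nonpos` or `h₄an`); it exhibits
`#Ш(E)_an = s ∈ ℚ`; if `ord_p s ≤ 0` the lower half is trivial, else `hZan` applies at the pair, at shallow frames replaced by the seat's unconditional
conductor-1 certificate `nonSurjCornerKolyZ_of_bottom_not_pow_divisible'`. CONDITIONAL on every binder; does NOT close 19065; nothing booked; T7.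
[cite: Miller2011LMS, Def. 1.1] [cite: Cha2005, Thm. 21 and Rmk. 25 (pp. 173–175)] [cite: JetchevSkinnerWan2017, §7.4.1–7.4.2] -/
theorem erratumRoadFive_nonSurjCorner_of_kolyZShaAn_of_kolyJMax_of_multiUpper_of_lowerX11aShaAn_of_twinMultDivisibility
    (hGZ : ∀ (N : ℕ) [NeZero N] (W : WeierstrassCurve ℚ) (K : Type) [Field K] [NumberField K],
      gross_zagier N W K)
    (hKo : ∀ (N : ℕ) [NeZero N] (W : WeierstrassCurve ℚ) (K : Type) [Field K] [NumberField K],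
      kolyvagin N W K)
    (hWu : sha_dvd_analyticSha)
    (hGZK : rank_eq_analyticRank_of_analyticRank_le_one) (hmod : hasEntireLFunction_rat)
    (hnf : exists_isNewformOf) (hpar : nonempty_modularParametrizationData)
    (hFHs : friedbergHoffstein_exists_heegnerField_split_twist_ne_zero)
    (hMaz : mazur_not_dvd_maninConstant_of_odd)
    (hrec : ∀ (N : ℕ) [NeZero N] (W : WeierstrassCurve ℚ) (K : Type) [Field K] [NumberField K],
      heegnerPointOfConductor_one_galoisConj N W K)
    (hD36 : ∀ (N : ℕ) [NeZero N] (W : WeierstrassCurve ℚ) (K : Type) [Field K] [NumberField K],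
      phi_heegnerTau_mem_singularModuliField N W K)
    (hJs : thm61_splitMultiplicative) (hJn : thm61_nonsplitMultiplicative)
    (hGS : ∀ (W : WeierstrassCurve ℚ) [W.IsElliptic] [W.IsGloballyMinimal] (p : ℕ) [Fact p.Prime],
      greenberg_stevens (W := W) (p := p))
    (hChaL : Cha2005.rmk25_pow_dvd_card_sha_primary_of_certificate)
    (hChaU : Cha2005.rmk25_padicValNat_card_sha_primary_add_le_of_globalDivisibility)
    -- the X11a lower half ONLY at the curves whose analytic `Ш` has positive `p`-valuation
    (h₄an : ∀ (Wd : WeierstrassCurve ℚ) [Wd.IsElliptic] [Wd.IsGloballyMinimal] (p : ℕ) [Fact p.Prime],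
      ClassX11a Wd p → (∀ q : ℚ, shaAn Wd = (q : ℂ) → 0 < padicValRat p q) → Typed.MissingLowerBoundAt Wd p)
    -- Zₚᶜ ONLY at the corner pairs with `0 < ord_p #Ш(E)_an`, and only at the DEEP frames
    (hZan : ∀ (W : WeierstrassCurve ℚ) [W.IsElliptic] [W.IsGloballyMinimal] (p : ℕ) [Fact p.Prime]
      (N : ℕ) [NeZero N] (K : Type) [Field K] [NumberField K]
      (Dt : ModularParametrizationData W N) (β : ℤ) (ι : K →+* ℂ),
      ClassX11b W p → ¬ Surj W p → (p = 5 ∨ p = 7) → p ∣ padicValInt p W.minimalDiscriminantInt →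
      ¬ Ram W p → (∃ s : ℚ, shaAn W = (s : ℂ) ∧ 0 < padicValRat p s) →
      W.conductorNorm ℤ = N → IsImaginaryQuadratic K →
      4 < (NumberField.discr K).natAbs → SatisfiesHeegnerHypothesis N K →
      SatisfiesHeegnerHypothesis p K → (4 * (N : ℤ)) ∣ β ^ 2 - NumberField.discr K → ¬ (p : ℤ) ∣ Dt.c →
      (∃ (d₁ : KolyvaginHeegnerData Dt β ι 1) (y : (W.baseChange K).toAffine.Point),
        WeierstrassCurve.Affine.Point.map (W' := W) (algebraMap K (ringClassField K ι 1)).toRatAlgHom y =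
          d₁.derivedPoint ∧
        ∃ Q : (W.baseChange K).toAffine.Point, ((p ^ (padicValNat p W.tamagawaProduct + 1) : ℕ) : ℤ) • Q = y) →
      ∃ M : ℕ, M ≤ padicValNat p W.tamagawaProduct ∧ CertificateAt Dt β ι p M)
    (hJmax : ∀ (W : WeierstrassCurve ℚ) [W.IsElliptic] [W.IsGloballyMinimal] [NeZero (W.conductorNorm ℤ)]
      (p : ℕ) [Fact p.Prime] (K : Type) [Field K] [NumberField K]
      (Dt : ModularParametrizationData W (W.conductorNorm ℤ)) (β : ℤ) (ι : K →+* ℂ),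
      p ∣ W.tamagawaProduct →
      ClassX11b W p → ¬ Surj W p → (p = 5 ∨ p = 7) → p ∣ padicValInt p W.minimalDiscriminantInt →
      ¬ Ram W p → IsImaginaryQuadratic K → 4 < (NumberField.discr K).natAbs →
      SatisfiesHeegnerHypothesis (W.conductorNorm ℤ) K → SatisfiesHeegnerHypothesis p K →
      (4 * (W.conductorNorm ℤ : ℤ)) ∣ β ^ 2 - NumberField.discr K → ¬ (p : ℤ) ∣ Dt.c →
      ∀ (v : HeightOneSpectrum (𝓞 ℚ)) (s : ℕ), s ≤ padicValNat p (W.tamagawaNumberAt v) →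
        ∀ (n : ℕ) (d : KolyvaginHeegnerData Dt β ι n), Squarefree n →
          (∀ ℓ ∈ n.primeFactors, Zhang2014.IsKolyvaginPrime (W.conductorNorm ℤ) W K p ℓ ∧
            s ≤ Zhang2014.kolyvaginIndex W p ℓ) → PDiv d p s)
    (hUmulti : ∀ (W : WeierstrassCurve ℚ) [W.IsElliptic] [W.IsGloballyMinimal] (p : ℕ) [Fact p.Prime],
      ClassX11b W p → ¬ Surj W p → (p = 5 ∨ p = 7) → p ∣ padicValInt p W.minimalDiscriminantInt →
      ¬ Ram W p → p ∣ W.tamagawaProduct →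
      (∀ v : HeightOneSpectrum (𝓞 ℚ), padicValNat p (W.tamagawaNumberAt v) < padicValNat p W.tamagawaProduct) →
      Typed.MissingUpperBoundAt W p)
    (hdiv : ∀ (Wd : WeierstrassCurve ℚ) [Wd.IsElliptic] [Wd.IsGloballyMinimal] (p : ℕ) [Fact p.Prime],
      ClassX11a Wd p → ¬ Surj Wd p → (p = 5 ∨ p = 7) →
      p ∣ padicValInt p Wd.minimalDiscriminantInt → MultDivisibilityAt Wd p) :
    Summit.BirchSwinnertonDyer.BirchSwinnertonDyer.Theses.ErratumRoadFive.NonSurjCorner := by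
  intro W _ _ p _ hX hns h57 hv hnr
  have hp5 : 5 ≤ p := by rcases h57 with h | h <;> omega
  -- the X11a lower half at every X11a curve at `p`: trivial off the `p ∣ #Ш_an` locus, `h₄an` on it
  have h₄ : ∀ (Wd : WeierstrassCurve ℚ) [Wd.IsElliptic] [Wd.IsGloballyMinimal], ClassX11a Wd p →
      Typed.MissingLowerBoundAt Wd p := by
    intro Wd _ _ hXa
    by_cases h : ∃ q : ℚ, shaAn Wd = (q : ℂ) ∧ padicValRat p q ≤ 0
    · obtain ⟨q, hq, hqv⟩ := h
      exact missingLowerBoundAt_of_shaAn_nonpos Wd p hq hqv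
    · push Not at h
      exact h₄an Wd p hXa h
  -- the Euler-system half of every non-surjective-leaf twin at this p, from the typed divisibility
  have hleafU : ∀ (Wd : WeierstrassCurve ℚ) [Wd.IsElliptic] [Wd.IsGloballyMinimal],
      ClassX11a Wd p → ¬ Surj Wd p → p ∣ padicValInt p Wd.minimalDiscriminantInt →
      Typed.MissingUpperBoundAt Wd p := fun Wd _ _ hXa hnsd hvd ↦
    missingUpperBoundAt_of_classX11a_of_multDivisibilityAt hJs hJn hGZK hmod hpar Wd p (hGS Wd p) hXa
      (hdiv Wd p hXa hnsd h57 hvd)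
  haveI : NeZero (W.conductorNorm ℤ) := ⟨(W.conductorNorm_pos_holds).ne'⟩
  -- the UPPER half, by CARRIER PROFILE (as in p579499)
  have hupper : Typed.MissingUpperBoundAt W p := by
    by_cases hcase : ¬ p ∣ W.tamagawaProduct ∨
        ∃ v : HeightOneSpectrum (𝓞 ℚ), padicValNat p W.tamagawaProduct ≤ padicValNat p (W.tamagawaNumberAt v)
    · refine missingUpperBoundAt_corner_of_jetchevDivisibility_of_twinLeafLower hGZ hKo hGZK hmod hnf hFHs hMaz
        hrec hD36 hChaU W p hX hns h57 hv hnr (fun Wd _ _ hXa _ _ ↦ h₄ Wd hXa) ?_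
      intro _ K _ _ Dt β ι hK hdisc hHN hHp hβ hc s hs n d hn hℓ
      rcases hcase with htam | ⟨v, hvt⟩
      · exact Summit.BirchSwinnertonDyer.BirchSwinnertonDyer.Theorems.nonSurjCornerKolyJ_of_not_dvd_tamagawa W p K
          Dt β ι htam hX hns h57 hv hnr hK hdisc hHN hHp hβ hc s hs n d hn hℓ
      · by_cases htam : p ∣ W.tamagawaProduct
        · exact hJmax W p K Dt β ι htam hX hns h57 hv hnr hK hdisc hHN hHp hβ hc v s (hs.trans hvt) n d hn hℓ
        · exact Summit.BirchSwinnertonDyer.BirchSwinnertonDyer.Theorems.nonSurjCornerKolyJ_of_not_dvd_tamagawa W p K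
            Dt β ι htam hX hns h57 hv hnr hK hdisc hHN hHp hβ hc s hs n d hn hℓ
    · push Not at hcase
      exact hUmulti W p hX hns h57 hv hnr hcase.1 hcase.2
  -- the LOWER half: trivial when `ord_p #Ш(E)_an ≤ 0`; otherwise Zₚᶜ at the Hoffstein–Luo frame (deep or shallow)
  obtain ⟨s, hs, hsv⟩ := hupper
  by_cases hs0 : padicValRat p s ≤ 0
  · exact Typed.missingPPartAt_of_lower_of_upper W p (missingLowerBoundAt_of_shaAn_nonpos W p hs hs0) ⟨s, hs, hsv⟩
  have hspos : ∃ s : ℚ, shaAn W = (s : ℂ) ∧ 0 < padicValRat p s := ⟨s, hs, lt_of_not_ge hs0⟩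
  refine Typed.missingPPartAt_of_lower_of_upper W p ?_ ⟨s, hs, hsv⟩
  refine missingLowerBoundAt_of_classX11b_of_indexLowerBoundNoSurj_of_upperTwist hGZ hKo hWu hGZK
    hmod hnf hFHs hMaz W p hX hp5
    (fun N _ K _ _ Dt H ι P hN hK hdisc hHN hHp hLt hP hc hPinf ↦
      indexLowerBoundAt_corner_of_certificates hGZ hKo hmod hrec hD36 hChaL W p N K Dt H ι P hX hp5 hN
        hK hdisc hHN hLt hP hPinf (by
          by_cases hdeep : ∃ (d₁ : KolyvaginHeegnerData Dt H.β ι 1) (y : (W.baseChange K).toAffine.Point),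
              WeierstrassCurve.Affine.Point.map (W' := W) (algebraMap K (ringClassField K ι 1)).toRatAlgHom y =
                d₁.derivedPoint ∧
              ∃ Q : (W.baseChange K).toAffine.Point, ((p ^ (padicValNat p W.tamagawaProduct + 1) : ℕ) : ℤ) • Q = y
          · exact hZan W p N K Dt H.β ι hX hns h57 hv hnr hspos hN hK hdisc hHN hHp H.dvd_sq_sub hc hdeep
          · push Not at hdeep
            exact nonSurjCornerKolyZ_of_bottom_not_pow_divisible' W p N K Dt H.β ι hX hns h57 hv hnr hN hK hdisc hHN
              hHp H.dvd_sq_sub hc (fun d₁ y hy hQ => by obtain ⟨Q, hQ⟩ := hQ; exact hdeep d₁ y hy Q hQ)))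
    ?_
  intro K _ _ Wd _ _ Cd hK hHN hLt hWd hnsd
  have hD0 : (NumberField.discr K : ℚ) ≠ 0 := by exact_mod_cast NumberField.discr_ne_zero K
  haveI : (W.quadraticTwist (NumberField.discr K : ℚ)).IsElliptic := W.isElliptic_quadraticTwist hD0
  have hrd : Wd.analyticRank = 0 := by
    rw [← hWd, analyticRank_smul]
    exact analyticRank_eq_zero_of_entireLFunction_one_ne_zero _ hLt
  have hXa : ClassX11a Wd p := classX11a_twist_of_not_ram W p hX hnr K hK hHN Cd hWd hrd
  have hpN : p ∣ W.conductorNorm ℤ := dvd_conductorNorm_of_mult hX.2.2.1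
  have hsq := isSquare_discr_padic_of_heegner K hK hHN p hpN
  have hvd : p ∣ padicValInt p Wd.minimalDiscriminantInt := by
    rw [padicValInt_minimalDiscriminantInt_twist_eq W p hD0 hsq Cd hWd]
    exact hv
  exact hleafU Wd hXa hnsd hvd

end Summit.BirchSwinnertonDyer.Rank1Residual.X11b

namespace Summit.BirchSwinnertonDyer.BirchSwinnertonDyer.Theorems

open CongruenceSubgroup WeierstrassCurve NumberField IsDedekindDomain Field Rat.HeightOneSpectrum
  Literature.NumberTheory.EllipticCurves
  Literature.NumberTheory.EllipticCurves.ModularForms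
  Literature.NumberTheory.EllipticCurves.Rank1Residual
  Literature.NumberTheory.EllipticCurves.Rank1Residual.Typed
  Literature.NumberTheory.EllipticCurves.Wuthrich2014
  Literature.NumberTheory.EllipticCurves.SteinWuthrich2013
  Literature.NumberTheory.EllipticCurves.Greenberg1999
  Literature.NumberTheory.EllipticCurves.Kato2004
  Literature.NumberTheory.EllipticCurves.BarriosEtAl2025
  Literature.NumberTheory.GaloisRepresentations Literature.NumberTheory.GaloisCohomology
  Literature.NumberTheory.Automorphic
  Summit.BirchSwinnertonDyer.Rank1Residual
  Summit.BirchSwinnertonDyer.Rank1Residual.X11b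
  Summit.BirchSwinnertonDyer.Rank1Residual.X11b.Three.Koly

/-! ### §2 Glue #7: the full hybrid composition with the `Ш_an` cut -/

/-- **THE HYBRID GLUE (glue #7) WITH THE `Ш_an` CUT ON BOTH CONVERSE-GRADE INPUTS.** As glue #6 (p593645): **`hZan`** (Kolyvagin certificates only
at the corner pairs with `0 < ord_p #Ш(E)_an`, only at DEEP frames — population 0 on the `p = 5` census) → `NonSurjCornerTwinMuAn` (19948) →
`KatoTwinFactsFiveAn` (19949) → **`h₄an`** (the X11a lower half only at curves with `0 < ord_p #Ш_an` for every rational value) → hMax (3 names) →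
hShim6 (6 names) → the SAVED display → `hres3bad` → `NonSurjCorner`. The registered by-name stubs `stub_kolyZ57` (19946) and `stub_lowerX11a57`
(19064) imply `hZan` ∕ `h₄an` a fortiori. CONDITIONAL on every binder; 19065 NOT closed; nothing booked; T7.
[cite: Miller2011LMS, Def. 1.1] [cite: Cha2005, Thm. 21 and Rmk. 25] [cite: JetchevSkinnerWan2017, §7.4.2] [cite: PapikianRabinoff2016, Cor. 3.5] -/
theorem nonSurjCorner_of_kolyZShaAn_of_twinMuAn_of_katoFacts_of_lowerX11aShaAn_of_sixNamedInputs_of_savedDisplay_of_threeBadSplit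
    (hZan : ∀ (W : WeierstrassCurve ℚ) [W.IsElliptic] [W.IsGloballyMinimal] (p : ℕ) [Fact p.Prime]
      (N : ℕ) [NeZero N] (K : Type) [Field K] [NumberField K]
      (Dt : ModularParametrizationData W N) (β : ℤ) (ι : K →+* ℂ),
      ClassX11b W p → ¬ Surj W p → (p = 5 ∨ p = 7) → p ∣ padicValInt p W.minimalDiscriminantInt →
      ¬ Ram W p → (∃ s : ℚ, shaAn W = (s : ℂ) ∧ 0 < padicValRat p s) →
      W.conductorNorm ℤ = N → IsImaginaryQuadratic K →
      4 < (NumberField.discr K).natAbs → SatisfiesHeegnerHypothesis N K →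
      SatisfiesHeegnerHypothesis p K → (4 * (N : ℤ)) ∣ β ^ 2 - NumberField.discr K → ¬ (p : ℤ) ∣ Dt.c →
      (∃ (d₁ : KolyvaginHeegnerData Dt β ι 1) (y : (W.baseChange K).toAffine.Point),
        WeierstrassCurve.Affine.Point.map (W' := W) (algebraMap K (ringClassField K ι 1)).toRatAlgHom y =
          d₁.derivedPoint ∧
        ∃ Q : (W.baseChange K).toAffine.Point, ((p ^ (padicValNat p W.tamagawaProduct + 1) : ℕ) : ℤ) • Q = y) →
      ∃ M : ℕ, M ≤ padicValNat p W.tamagawaProduct ∧ CertificateAt Dt β ι p M)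
    (hμ : NonSurjCornerTwinMuAn)
    (hF : Summit.BirchSwinnertonDyer.BirchSwinnertonDyer.Theses.ErratumRoadFive.KatoTwinFactsFiveAn)
    (h₄an : ∀ (Wd : WeierstrassCurve ℚ) [Wd.IsElliptic] [Wd.IsGloballyMinimal] (p : ℕ) [Fact p.Prime],
      ClassX11a Wd p → (∀ q : ℚ, shaAn Wd = (q : ℂ) → 0 < padicValRat p q) → Typed.MissingLowerBoundAt Wd p)
    (hMax : GrossLMS1991.prop37_2_frobeniusCongruence ∧
      (∀ (K : Type) [Field K] [NumberField K], poitouTate_selmerStructure_duality_conj K) ∧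
      Gross1991_heegnerPoint_sub_ratTorsion_mem_E0_imageFree)
    (hShim6 : friedbergHoffstein_exists_twist_ne_zero_inertAt ∧ nonempty_shimuraParametrizationData ∧
      PastenShimura2024_componentOrders ∧
      (∀ (K : Type) [Field K] [NumberField K], casselsTate_levelInputs K) ∧
      shimuraCurve_heegnerSystem_primitivesFromFiveIrr ∧ shimuraCurve_heegnerSystem_primitivesSplitReduced)
    (hSav : ∀ (W : WeierstrassCurve ℚ) [W.IsElliptic] [W.IsGloballyMinimal] (p : ℕ) [Fact p.Prime],
      ClassX11b W p → ¬ Surj W p → (p = 5 ∨ p = 7) → ∀ (q₁ : ℕ) [Fact q₁.Prime], ShimuraInertSavedDisplayAt W p q₁)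
    (hres3bad : ∀ (W : WeierstrassCurve ℚ) [W.IsElliptic] [W.IsGloballyMinimal] (p : ℕ) [Fact p.Prime],
      ClassX11b W p → ¬ Surj W p → (p = 5 ∨ p = 7) → p ∣ padicValInt p W.minimalDiscriminantInt → ¬ Ram W p →
      ∀ (q₁ q₂ q₃ : ℕ) [Fact q₁.Prime] [Fact q₂.Prime] [Fact q₃.Prime], q₁ ≠ p → q₂ ≠ p → q₃ ≠ p →
      q₁ ≠ q₂ → q₁ ≠ q₃ → q₂ ≠ q₃ →
      W.HasSplitMultiplicativeReductionAtPrime q₁ → W.HasSplitMultiplicativeReductionAtPrime q₂ →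
      W.HasSplitMultiplicativeReductionAtPrime q₃ →
      (q₁ = 2 ∨ p ∣ q₁ - 1) → (q₂ = 2 ∨ p ∣ q₂ - 1) → (q₃ = 2 ∨ p ∣ q₃ - 1) → Typed.MissingUpperBoundAt W p) :
    Summit.BirchSwinnertonDyer.BirchSwinnertonDyer.Theses.ErratumRoadFive.NonSurjCorner := by
  obtain ⟨hGZ, hKo, hWu, hGZK, hmod, hnf, hpar, hFHs, hMaz, hrec, hD36, hJs, hJn, hGS, hChaL, hChaU, hne, h12,
    hns, hsp, h15, h18, hfine⟩ := hF
  obtain ⟨h37, hPTs, hF1⟩ := hMax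
  obtain ⟨hFH, hJL, hCO, hCT, hLab, hLabS⟩ := hShim6
  have hPT : ∀ (K : Type) [Field K] [NumberField K],
      Literature.NumberTheory.GaloisCohomology.poitouTate_sum_localTatePairing_eq_zero K :=
    poitouTate_sum_localTatePairing_eq_zero_holds
  have hBR : localTamagawaNumber_quadraticTwist_two_mem_of_goodReduction :=
    BarriosEtAl2025.localTamagawaNumber_quadraticTwist_two_mem_of_goodReduction_holds
  -- the X11a lower half at every X11a curve (trivial off the `p ∣ #Ш_an` locus), for the Shimura roads' twin input
  have h₄ : ∀ (Wd : WeierstrassCurve ℚ) [Wd.IsElliptic] [Wd.IsGloballyMinimal] (p : ℕ) [Fact p.Prime], ClassX11a Wd p →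
      Typed.MissingLowerBoundAt Wd p := by
    intro Wd _ _ p _ hXa
    by_cases h : ∃ q : ℚ, shaAn Wd = (q : ℂ) ∧ padicValRat p q ≤ 0
    · obtain ⟨q, hq, hqv⟩ := h
      exact missingLowerBoundAt_of_shaAn_nonpos Wd p hq hqv
    · push Not at h
      exact h₄an Wd p hXa h
  exact X11b.erratumRoadFive_nonSurjCorner_of_kolyZShaAn_of_kolyJMax_of_multiUpper_of_lowerX11aShaAn_of_twinMultDivisibility hGZ hKo
    hWu hGZK hmod hnf hpar hFHs hMaz hrec hD36 hJs hJn hGS hChaL hChaU h₄an hZan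
    (X11b.Three.Koly.nonSurjCornerKolyJ_max_of_threeNamedFacts h37 hPTs hF1)
    (fun W _ _ p _ hX hns' h57 hv hnr htam hmulti ↦ by
      by_cases h3 : ∃ (q₁ q₂ q₃ : ℕ) (_ : Fact q₁.Prime) (_ : Fact q₂.Prime) (_ : Fact q₃.Prime), q₁ ≠ p ∧ q₂ ≠ p ∧ q₃ ≠ p ∧
          q₁ ≠ q₂ ∧ q₁ ≠ q₃ ∧ q₂ ≠ q₃ ∧ W.HasSplitMultiplicativeReductionAtPrime q₁ ∧
          W.HasSplitMultiplicativeReductionAtPrime q₂ ∧ W.HasSplitMultiplicativeReductionAtPrime q₃ ∧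
          (q₁ = 2 ∨ p ∣ q₁ - 1) ∧ (q₂ = 2 ∨ p ∣ q₂ - 1) ∧ (q₃ = 2 ∨ p ∣ q₃ - 1)
      · obtain ⟨q₁, q₂, q₃, i₁, i₂, i₃, h1p, h2p, h3p, h12', h13, h23, hs1, hs2, hs3, hb1, hb2, hb3⟩ := h3
        haveI := i₁; haveI := i₂; haveI := i₃
        exact hres3bad W p hX hns' h57 hv hnr q₁ q₂ q₃ h1p h2p h3p h12' h13 h23 hs1 hs2 hs3 hb1 hb2 hb3
      · have hno : ∀ (q₁ q₂ q₃ : ℕ) [Fact q₁.Prime] [Fact q₂.Prime] [Fact q₃.Prime], q₁ ≠ p → q₂ ≠ p → q₃ ≠ p →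
            q₁ ≠ q₂ → q₁ ≠ q₃ → q₂ ≠ q₃ →
            W.HasSplitMultiplicativeReductionAtPrime q₁ → W.HasSplitMultiplicativeReductionAtPrime q₂ →
            W.HasSplitMultiplicativeReductionAtPrime q₃ →
            (q₁ = 2 ∨ p ∣ q₁ - 1) → (q₂ = 2 ∨ p ∣ q₂ - 1) → (q₃ = 2 ∨ p ∣ q₃ - 1) → False :=
          fun q₁ q₂ q₃ _ _ _ h1p h2p h3p h12' h13 h23 hs1 hs2 hs3 hb1 hb2 hb3 ↦
            h3 ⟨q₁, q₂, q₃, inferInstance, inferInstance, inferInstance, h1p, h2p, h3p, h12', h13, h23, hs1, hs2, hs3,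
              hb1, hb2, hb3⟩
        rcases NonSurjCorner.admissibleUpToOneDatum_of_atMostTwoBadSplit W p hX hns' h57 htam hmulti hno with
          hadm | ⟨q₁, hq₁F, hq₁, hdat⟩
        · exact NonSurjCorner.missingUpperBoundAt_of_admissibleSet_of_primitives hGZK hmod hnf hFH hMaz hJL hCO hPT hCT hLab
            hLabS W p hX hns' h57 hnr (fun Wd _ _ hXa ↦ h₄ Wd p hXa) hadm
        · haveI := hq₁F
          exact NonSurjCorner.missingUpperBoundAt_of_admissibleUpToOne_of_savedDisplay hGZK hmod hnf hFH hMaz hBR hJL hCO W p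
            hX hns' h57 hnr (fun Wd _ _ hXa ↦ h₄ Wd p hXa) q₁ hq₁ (hSav W p hX hns' h57 q₁) hdat)
    (fun Wd _ _ p _ hXa hnsd h57 hvd ↦
      X11b.multDivisibilityAt_of_katoFacts_of_muAn hne h12 hns hsp h15 h18 hfine Wd p hXa.2.1 hXa.2.2.1
        hXa.2.2.2.1 hnsd (fun f hf ϖ hϖ a L hsa hna hL ↦ hμ Wd p hXa hnsd h57 hvd f hf ϖ hϖ a L hsa hna hL))

end Summit.BirchSwinnertonDyer.BirchSwinnertonDyer.Theorems

end
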